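import Literature.AnabelianGeometry.EtaleTheta.SettingModelTateRigidityOfRecord
import Literature.AnabelianGeometry.EtaleTheta.SettingModelTateProp15TruthTable
import HarnessLib

/-!
# [EtTh] §2 over §1 AT THE TATE INSTANCE: the rigidity data of record — the CLOSED census (Galois section `s := inr`)

Mochizuki, *The Étale Theta Function …* [EtTh], Publ. RIMS **45** (2009), §1 Prop. 1.3 p. 20, Prop. 1.5 p. 23; §2 Prop. 2.12
p. 45, Prop. 2.14 p. 49, Cor. 2.18 pp. 59–63 [cite: MochizukiEtTh2009, Prop 2.14 (i) p.49].  Cell `abc-iut`, layer L2, seat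
abc-iut-L2-t8 (gen 6); R78 cluster STAGE 2, row #5 — the one-step sequel of `SettingModelTateRigidityOfRecord`
(`exists_rigidData_sec2_rows_modelTate_of_section`, every Galois section) at the Galois factor `inr : G_{ℚ_p} → Π^tp_X`
(abc-iut-L2-t5's `continuous_inrχq`, `aug ∘ inr = id` by `rfl`, and the section clauses `map_inr_GK_le_GtpY_modelχq'` /
`map_inr_GKdd_le_GtpYdd_modelχq'` of `SettingModelTateProp15TruthTable` (R270 census closer) — BY NAME; same datum as that file's
`prop15_i_ii_iii_inrSection_modelχq`).  PROOF-ONLY (2 theorems); nothing restated.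
* **`exists_rigidData_sec2_rows_modelTate`** — NO hypothesis: at `modelTate p = modelχq p 1 2` there EXIST an étale-theta
  datum `E` with `η̈^Θ = η̈♯`, Prop. 1.3, Prop. 1.5 (i), (ii) AND (iii), a choice `X̲̲` (`Π^tp_X̲̲ = Huuχq`), a cyclotome
  identification and a cusp labelling such that the §1 → §2 adapter's rigidity data satisfy Prop. 2.12 (i)(ii), Prop. 2.14 (i),
  Cor. 2.18 (iv) fibre, Cor. 2.18 (iii) (both clauses), Prop. 2.14 (iii) mono/bi;
* **`ThetaSetting.exists_isEtThOrigin_prop15_rigidData_sec2_rows`** — the setting-free form (∃ D with `IsEtThOrigin`,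
  `Sec2Hyps`, …): the first binder-free kernel inhabitant of `RigidData N l` from §1 data satisfying the whole typed §1
  root package, with the §2 rows — REFUTED over the lawless interface (abc-iut-w5-d175's toys) — TRUE at it.
HONEST LABEL: SEMI-SYNTHETIC model (consistency / joint-satisfiability evidence for the typed interface only; not the tempered
`π₁` of a curve); nothing of [EtTh] asserted; no side taken on [IUTchIII] Cor. 3.12; typed ≠ proved.
-/

noncomputable section

namespace Literature.AnabelianGeometry.EtaleTheta.SettingModel

open Literature.AnabelianGeometry.SemiGraphs

variable (p : ℕ) [Fact p.Prime] (l : ℕ+) (hl : Odd (l : ℕ))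

/-! ## The CLOSED instance: the Galois factor `inr` as the section -/

include hl in
/-- **CLOSED CENSUS at the Tate instance `modelTate p = modelχq p 1 2`** — NO binder at all: there EXIST an étale-theta
datum `E` over the stage-2 model with `η̈^Θ = η̈♯`, Prop. 1.3, Prop. 1.5 (i), (ii) AND (iii), a choice `X̲̲` (`Π^tp_X̲̲ = Huuχq`),
a level-`N` cyclotome identification and a cusp labelling such that the rigidity data produced by the §1 → §2 adapter
satisfy Prop. 2.12 (i), (ii), Prop. 2.14 (i), Cor. 2.18 (iv) fibre, Cor. 2.18 (iii) (both), Prop. 2.14 (iii) mono, bi —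
witness: the `inr`-section datum of `SettingModelTateProp15TruthTable`. [cite: MochizukiEtTh2009, Prop 2.14 (i) p.49] -/
theorem exists_rigidData_sec2_rows_modelTate (N : ℕ+) :
    ∃ (E : (ThetaSetting.modelTate p).EtaleThetaData) (C : E.DoubleUnderline l)
      (μ : (ThetaSetting.modelTate p).CyclotomeMod l N)
      (h15 : ThetaSetting.Prop15iii E (compat_modelχq p 1 2 even_two)) (L : C.CuspLabels),
      E.etaDd = etaDdχq p 1 2 even_two ∧ ThetaSetting.Prop13 E ∧
      ThetaSetting.Prop15i E.toKummerData (compat_modelχq p 1 2 even_two) ∧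
      ThetaSetting.Prop15ii E.toKummerData (compat_modelχq p 1 2 even_two) ∧ C.Huu = Huuχq p 1 2 l hl ∧
      Literature.AnabelianGeometry.EtaleTheta.RigidData.Prop212_i
          (C.rigidData μ (compat_modelχq p 1 2 even_two) (ThetaSetting.modelχq_sec2Hyps p 1 2 even_two) h15 L) ∧
      Literature.AnabelianGeometry.EtaleTheta.RigidData.Prop212_ii
          (C.rigidData μ (compat_modelχq p 1 2 even_two) (ThetaSetting.modelχq_sec2Hyps p 1 2 even_two) h15 L) ∧
      Literature.AnabelianGeometry.EtaleTheta.RigidData.Prop214_i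
          (C.rigidData μ (compat_modelχq p 1 2 even_two) (ThetaSetting.modelχq_sec2Hyps p 1 2 even_two) h15 L) ∧
      Literature.AnabelianGeometry.EtaleTheta.RigidData.Cor218_iv_fibre
          (C.rigidData μ (compat_modelχq p 1 2 even_two) (ThetaSetting.modelχq_sec2Hyps p 1 2 even_two) h15 L) ∧
      Literature.AnabelianGeometry.EtaleTheta.RigidData.Cor218_iii_PiX
          (C.rigidData μ (compat_modelχq p 1 2 even_two) (ThetaSetting.modelχq_sec2Hyps p 1 2 even_two) h15 L) ∧
      Literature.AnabelianGeometry.EtaleTheta.RigidData.Cor218_iii_quotient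
          (C.rigidData μ (compat_modelχq p 1 2 even_two) (ThetaSetting.modelχq_sec2Hyps p 1 2 even_two) h15 L) ∧
      Literature.AnabelianGeometry.EtaleTheta.RigidData.Prop214_iii_mono
          (C.rigidData μ (compat_modelχq p 1 2 even_two) (ThetaSetting.modelχq_sec2Hyps p 1 2 even_two) h15 L) ∧
      Literature.AnabelianGeometry.EtaleTheta.RigidData.Prop214_iii_bi
          (C.rigidData μ (compat_modelχq p 1 2 even_two) (ThetaSetting.modelχq_sec2Hyps p 1 2 even_two) h15 L) :=
  exists_rigidData_sec2_rows_modelTate_of_section p l hl SemidirectProduct.inr (continuous_inrχq p 1 2)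
    (fun _ => rfl) (map_inr_GK_le_GtpY_modelχq' p 1 2 even_two) (map_inr_GKdd_le_GtpYdd_modelχq' p 1 2 even_two) N

include hl in
/-- **SETTING-FREE CLOSED CENSUS**: some theta setting satisfying the §1 guard `IsEtThOrigin` and `Sec2Hyps` carries an
étale-theta datum with Prop. 1.3 and Prop. 1.5 (i), (ii), (iii), a choice `X̲̲`, a level-`N` cyclotome identification and a
cusp labelling such that the §1 → §2 adapter's rigidity data satisfy the eight §2 rows above (witness: the Tate instance).
[cite: MochizukiEtTh2009, Prop 2.14 (i) p.49] -/
theorem _root_.Literature.AnabelianGeometry.EtaleTheta.ThetaSetting.exists_isEtThOrigin_prop15_rigidData_sec2_rows (N : ℕ+) :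
    ∃ (D : ThetaSetting p) (_ : D.IsEtThOrigin) (hS : D.Sec2Hyps) (E : D.EtaleThetaData) (C : E.DoubleUnderline l)
      (μ : D.CyclotomeMod l N) (h15 : ThetaSetting.Prop15iii E hS.compat) (L : C.CuspLabels),
      ThetaSetting.Prop13 E ∧ ThetaSetting.Prop15i E.toKummerData hS.compat ∧
      ThetaSetting.Prop15ii E.toKummerData hS.compat ∧
      Literature.AnabelianGeometry.EtaleTheta.RigidData.Prop212_i (C.rigidData μ hS.compat hS h15 L) ∧
      Literature.AnabelianGeometry.EtaleTheta.RigidData.Prop212_ii (C.rigidData μ hS.compat hS h15 L) ∧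
      Literature.AnabelianGeometry.EtaleTheta.RigidData.Prop214_i (C.rigidData μ hS.compat hS h15 L) ∧
      Literature.AnabelianGeometry.EtaleTheta.RigidData.Cor218_iv_fibre (C.rigidData μ hS.compat hS h15 L) ∧
      Literature.AnabelianGeometry.EtaleTheta.RigidData.Cor218_iii_PiX (C.rigidData μ hS.compat hS h15 L) ∧
      Literature.AnabelianGeometry.EtaleTheta.RigidData.Cor218_iii_quotient (C.rigidData μ hS.compat hS h15 L) ∧
      Literature.AnabelianGeometry.EtaleTheta.RigidData.Prop214_iii_mono (C.rigidData μ hS.compat hS h15 L) ∧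
      Literature.AnabelianGeometry.EtaleTheta.RigidData.Prop214_iii_bi (C.rigidData μ hS.compat hS h15 L) := by
  obtain ⟨E, C, μ, h15, L, -, h13, h15i, h15ii, -, hrows⟩ := exists_rigidData_sec2_rows_modelTate p l hl N
  exact ⟨ThetaSetting.modelχq p 1 2 even_two, ThetaSetting.modelχq_isEtThOrigin p 1 2 even_two,
    ThetaSetting.modelχq_sec2Hyps p 1 2 even_two, E, C, μ, h15, L, h13, h15i, h15ii, hrows⟩

end Literature.AnabelianGeometry.EtaleTheta.SettingModel

end
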